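import Summits.QuantumAdvantage.QuantumAdvantage.Theorems.PurityDialLawA

/-! # PurityDialLawB — part 2/13 (mechanical split for landing of `PurityDialLaw`; content verbatim; scopes re-opened with their variables) -/

set_option linter.dupNamespace false
noncomputable section

namespace Summit.QuantumAdvantage.QuantumAdvantage.Theorems.PurityDialLaw
open Classical Finset Summit.QuantumAdvantage.AdviceFreeQNC0
open Literature.Computability.MetaComplexity Literature.Computability.MetaComplexity.Smolensky
open Literature.Computability.Complexity (parityFn)

section Dial
variable {m : ℕ}

/-! #### (b′) the purity threshold `2d+1` is EXACT: the elementary symmetric reader `e_{p−1} (mod p)` -/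

/-- `Σ_{|T| = k} x_T (z) = C(|z|, k)`. -/
theorem sum_mono_powersetCard_apply {F : Type*} [Field F] {N : ℕ} (k : ℕ) (z : Fin N → Bool) :
    (∑ T ∈ (univ : Finset (Fin N)).powersetCard k, mono F T) z =
      (((univ.filter fun i => z i = true).card.choose k : ℕ) : F) := by
  rw [Finset.sum_apply]
  simp only [mono_apply]
  rw [Finset.sum_boole, ← Finset.card_powersetCard]
  congr 2
  ext T
  simp only [mem_filter, mem_powersetCard, subset_univ, true_and]
  constructor
  · rintro ⟨hT, hall⟩
    exact ⟨fun i hi => by rw [mem_filter]; exact ⟨mem_univ _, hall i hi⟩, hT⟩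
  · rintro ⟨hsub, hT⟩
    exact ⟨hT, fun i hi => (mem_filter.1 (hsub hi)).2⟩

/-- `C(w, p−1) ≡ [w = p−1] (mod p)` for `w ≤ 2p−2`. -/
theorem choose_pred_cast_eq {p : ℕ} [hp : Fact p.Prime] {w : ℕ} (hw : w ≤ 2 * p - 2) :
    ((w.choose (p - 1) : ℕ) : ZMod p) = if w = p - 1 then 1 else 0 := by
  have hp1 : 1 ≤ p := hp.out.one_lt.le
  by_cases h : w = p - 1
  · rw [if_pos h, h, Nat.choose_self, Nat.cast_one]
  · rw [if_neg h]
    rcases lt_or_gt_of_ne h with hlt | hgt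
    · rw [Nat.choose_eq_zero_of_lt hlt, Nat.cast_zero]
    · have hdvd : p ∣ w.choose (p - 1) :=
        hp.out.dvd_choose (by omega) (by omega) (by omega)
      exact (ZMod.natCast_eq_zero_iff _ _).2 hdvd

/-- **SHARPNESS of the purity threshold** (PROVED, every odd prime): on `m = 2d` bits with `d = p − 1`, the reader
`z ↦ [|z| = p−1] = e_{p−1}(z) mod p` is Boolean, of `𝔽_p`-degree `≤ d`, non-zero, and PURE (its level set is the
weight-`(p−1)` layer, all EVEN). So the `R = ∞` end of the dial sits exactly at `τ(d) = 2d+1`. -/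
theorem purity_sharp (p : ℕ) [hp : Fact p.Prime] (hp2 : p ≠ 2) :
    ∃ f : (Fin (2 * (p - 1)) → Bool) → Bool, HasDegF p f (p - 1) ∧
      (∀ z, f z = true → parityFn (2 * (p - 1)) z = false) ∧ f ≠ fun _ => false := by
  set m := 2 * (p - 1) with hm
  have hp3 : 3 ≤ p := by
    have := hp.out.two_le; omega
  refine ⟨fun z => decide ((univ.filter fun i => z i = true).card = p - 1), ?_, ?_, ?_⟩
  · -- degree: the indicator is `Σ_{|T| = p−1} x_T`
    unfold HasDegF
    have hfun : (fun x : Fin m → Bool =>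
        if decide ((univ.filter fun i => x i = true).card = p - 1) = true then (1 : ZMod p) else 0) =
        ∑ T ∈ (univ : Finset (Fin m)).powersetCard (p - 1), mono (ZMod p) T := by
      funext x
      rw [sum_mono_powersetCard_apply, choose_pred_cast_eq]
      · simp only [decide_eq_true_eq]
      · have : (univ.filter fun i => x i = true).card ≤ m := (card_filter_le _ _).trans (by simp [hm])
        omega
    rw [hfun]
    exact Submodule.sum_mem _ fun T hT => mono_mem_lowDeg (le_of_eq (mem_powersetCard.1 hT).2)
  · -- purity: the layer `|z| = p − 1` is even
    intro z hz
    have hz' : (univ.filter fun i => z i = true).card = p - 1 := by simpa using hz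
    have heven : (p - 1) % 2 = 0 := by
      rcases hp.out.eq_two_or_odd with h2 | hodd
      · exact absurd h2 hp2
      · omega
    unfold parityFn Literature.Computability.Complexity.GateFn.numOnes
    rw [hz', heven]; decide
  · -- non-zero: the point `1^{p−1} 0^{p−1}`
    intro h
    have hz := congrFun h (fun i : Fin m => decide (i.val < p - 1))
    simp only [decide_eq_false_iff_not] at hz
    apply hz
    have : (univ.filter fun i : Fin m => decide (i.val < p - 1) = true) = univ.filter fun i : Fin m => i.val < p - 1 :=
      Finset.filter_congr fun i _ => by rw [decide_eq_true_eq]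
    rw [this, Fin.card_filter_val_lt, hm]
    omega

/-- hence NO member of the dial survives the threshold `τ d = 2d`, whatever the ratio: the `τ`-axis of the dial starts
at `2d+1` (PROVED). -/
theorem not_lawAt_two_mul (p : ℕ) [Fact p.Prime] (hp2 : p ≠ 2) (R : ℕ) : ¬ LawAt p R (fun d => 2 * d) := by
  intro hlaw
  obtain ⟨f, hdeg, hpure, hne⟩ := purity_sharp p hp2
  have hbal := hlaw (2 * (p - 1)) (p - 1) le_rfl f hdeg
  apply hne
  have ho : oddPart f = ∅ := by
    rw [oddPart, Finset.filter_eq_empty_iff]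
    rintro z - ⟨hz, hpz⟩
    rw [hpure z hz] at hpz; exact Bool.false_ne_true hpz
  have he : (evenPart f).card = 0 := by
    have := hbal.2; rw [ho, card_empty, Nat.mul_zero] at this; omega
  rw [Finset.card_eq_zero, evenPart, Finset.filter_eq_empty_iff] at he
  funext z
  cases hfz : f z
  · rfl
  · exfalso
    have hpz := hpure z hfz
    exact he (mem_univ z) ⟨hfz, hpz⟩

/-! #### (c) the `R < ∞` end at EXPONENTIAL threshold: DLSZ + absolute Smolensky (PROVED) -/

/-- the level set splits into its two parity parts. -/
theorem card_level_eq (f : (Fin m → Bool) → Bool) :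
    (univ.filter fun z => f z = true).card = (oddPart f).card + (evenPart f).card := by
  unfold oddPart evenPart
  rw [← card_union_of_disjoint]
  · congr 1; ext z; simp only [mem_union, mem_filter, mem_univ, true_and]; cases parityFn m z <;> simp
  · exact disjoint_filter.2 fun z _ h1 h2 => by rw [h1.2] at h2; exact Bool.noConfusion h2.2

/-- **EXPONENTIAL-THRESHOLD RELATIVE SMOLENSKY** (PROVED): for an odd prime `p`, every Boolean function of
`𝔽_p`-degree `≤ d` on `m ≥ (d+1)²·4^{d+1}` bits is `3`-balanced.  (DLSZ: a non-empty degree-`d` level set has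
`≥ 2^{m−d}` points; Smolensky twice: `|#odd − #even| ≤ d·C(m, m/2) ≤ d·2^m/√m ≤ 2^{m−d−1}`.) -/
theorem relBal_three_of_exp {p : ℕ} [hp : Fact p.Prime] (hp2 : p ≠ 2) {d : ℕ}
    (hm : (d + 1) ^ 2 * 4 ^ (d + 1) ≤ m) {f : (Fin m → Bool) → Bool} (hf : HasDegF p f d) : RelBal 3 f := by
  have h4 : 1 ≤ 4 ^ (d + 1) := Nat.one_le_pow _ _ (by norm_num)
  have hd1m : d + 1 ≤ m := by nlinarith
  have hm1 : 1 ≤ m := by omega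
  have hdm : d ≤ m := by omega
  have h2 : (2 : ZMod p) ≠ 0 := (by
    -- `2 ≠ 0` in `ZMod p`, `p ≠ 2` prime (inlined folklore; cf. KroneckerSplitting.two_ne_zero_zmod)
    intro h
    have h' : p ∣ 2 := by
      have : ((2 : ℕ) : ZMod p) = 0 := by exact_mod_cast h
      exact (ZMod.natCast_eq_zero_iff 2 p).1 this
    exact hp2 ((Nat.prime_dvd_prime_iff_eq (Fact.out) Nat.prime_two).1 h'))
  set P : CubeFn (ZMod p) m := fun x => if f x = true then (1 : ZMod p) else 0 with hPdef
  have hP : P ∈ lowDeg (ZMod p) m d := hf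
  have hQ : (1 - P) ∈ lowDeg (ZMod p) m d := Submodule.sub_mem _ (one_mem_lowDeg d) hP
  set a := (oddPart f).card with ha
  set b := (evenPart f).card with hb
  set X := d * m.choose (m / 2) with hX
  -- Smolensky for `P`: `a ≤ b + X`
  have hA1 : (univ.filter fun x => P x = if parityFn m x then 1 else 0).card ≤ 2 ^ (m - 1) + d * m.choose (m / 2) := by
    convert parity_agreement_le' h2 hP using 3
  have hE := Summit.QuantumAdvantage.QuantumAdvantage.Theorems.PairFreezing.Pairing.card_filter_parityFn m hm1 false
  have hO := Summit.QuantumAdvantage.QuantumAdvantage.Theorems.PairFreezing.Pairing.card_filter_parityFn m hm1 true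
  have hid1 : (univ.filter fun x => P x = if parityFn m x then 1 else 0).card + b =
      a + (univ.filter fun z : Fin m → Bool => parityFn m z = false).card := by
    rw [ha, hb]; unfold oddPart evenPart
    rw [← card_union_of_disjoint, ← card_union_of_disjoint]
    · congr 1; ext x; simp only [mem_union, mem_filter, mem_univ, true_and, hPdef]
      cases hfx : f x <;> cases hpx : parityFn m x <;> simp
    · exact disjoint_filter.2 fun x _ h1 h3 => by rw [h1.2] at h3; exact Bool.noConfusion h3
    · refine disjoint_filter.2 fun x _ h1 h3 => ?_
      rw [hPdef] at h1; simp only at h1; rw [h3.1, h3.2] at h1; simp at h1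
  have hab : a ≤ b + X := by rw [hE] at hid1; omega
  -- Smolensky for `1 − P`: `b ≤ a + X`
  have hA2 : (univ.filter fun x => (1 - P) x = if parityFn m x then 1 else 0).card ≤
      2 ^ (m - 1) + d * m.choose (m / 2) := by
    convert parity_agreement_le' h2 hQ using 3
  have hid2 : (univ.filter fun x => (1 - P) x = if parityFn m x then 1 else 0).card + a =
      b + (univ.filter fun z : Fin m → Bool => parityFn m z = true).card := by
    rw [ha, hb]; unfold oddPart evenPart
    rw [← card_union_of_disjoint, ← card_union_of_disjoint]
    · congr 1; ext x; simp only [mem_union, mem_filter, mem_univ, true_and, hPdef, Pi.sub_apply, Pi.one_apply]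
      cases hfx : f x <;> cases hpx : parityFn m x <;> simp
    · exact disjoint_filter.2 fun x _ h1 h3 => by rw [h1.2] at h3; exact Bool.noConfusion h3
    · refine disjoint_filter.2 fun x _ h1 h3 => ?_
      rw [hPdef] at h1; simp only [Pi.sub_apply, Pi.one_apply] at h1; rw [h3.1, h3.2] at h1; simp at h1
  have hba : b ≤ a + X := by rw [hO] at hid2; omega
  -- DLSZ: a non-empty level set of degree `d` has `≥ 2^{m−d}` points
  by_cases hP0 : P = 0
  · have hzero : ∀ z, f z = false := by
      intro z; have hz := congrFun hP0 z
      simp only [hPdef, Pi.zero_apply] at hz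
      cases hfz : f z
      · rfl
      · rw [hfz, if_pos rfl] at hz; exact absurd hz one_ne_zero
    have ha0 : a = 0 := by
      rw [ha, Finset.card_eq_zero, oddPart, Finset.filter_eq_empty_iff]; intro z _; simp [hzero z]
    have hb0 : b = 0 := by
      rw [hb, Finset.card_eq_zero, evenPart, Finset.filter_eq_empty_iff]; intro z _; simp [hzero z]
    refine ⟨?_, ?_⟩ <;> simp only [← ha, ← hb, ha0, hb0] <;> simp
  have hsupp : 2 ^ (m - d) ≤ a + b := by
    have h := two_pow_le_card_support hP hP0
    rw [← card_level_eq f]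
    refine h.trans (le_of_eq (congrArg Finset.card (Finset.filter_congr fun x _ => ?_)))
    simp only [hPdef]
    cases f x <;> simp
  -- the real estimate `2·X·2^d ≤ 2^m`
  have hXR : (2 : ℝ) * X * 2 ^ d ≤ 2 ^ m := by
    have hC : ((m.choose (m / 2) : ℕ) : ℝ) ≤ 2 ^ m / Real.sqrt m := by
      have h := BlockParity.choose_half_mul_pow_le hm1 le_rfl
      rwa [Nat.sub_self, pow_zero, mul_one] at h
    have hsq : ((d : ℝ) * 2 ^ (d + 1)) ^ 2 ≤ m := by
      have h1 : ((d ^ 2 * 4 ^ (d + 1) : ℕ) : ℝ) ≤ m := by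
        have : d ^ 2 * 4 ^ (d + 1) ≤ m := le_trans (Nat.mul_le_mul_right _ (by nlinarith)) hm
        exact_mod_cast this
      have h2 : ((d : ℝ) * 2 ^ (d + 1)) ^ 2 = ((d ^ 2 * 4 ^ (d + 1) : ℕ) : ℝ) := by
        push_cast
        rw [mul_pow, ← pow_mul, show (4 : ℝ) = 2 ^ 2 by norm_num, ← pow_mul, mul_comm 2 (d + 1)]
      rwa [h2]
    have hs : (d : ℝ) * 2 ^ (d + 1) ≤ Real.sqrt m := by
      have h0 : (0 : ℝ) ≤ d * 2 ^ (d + 1) := by positivity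
      rw [← Real.sqrt_sq h0]
      exact Real.sqrt_le_sqrt hsq
    have hmpos : (0 : ℝ) < Real.sqrt m := Real.sqrt_pos.2 (by exact_mod_cast hm1)
    rw [hX]; push_cast
    calc (2 : ℝ) * (d * (m.choose (m / 2) : ℝ)) * 2 ^ d = (d * 2 ^ (d + 1)) * (m.choose (m / 2) : ℝ) := by ring
      _ ≤ (d * 2 ^ (d + 1)) * (2 ^ m / Real.sqrt m) := mul_le_mul_of_nonneg_left hC (by positivity)
      _ ≤ Real.sqrt m * (2 ^ m / Real.sqrt m) := mul_le_mul_of_nonneg_right hs (by positivity)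
      _ = 2 ^ m := by field_simp
  have h2X : 2 * X ≤ a + b := by
    have hpow : (2 : ℝ) ^ (m - d) * 2 ^ d = 2 ^ m := by rw [← pow_add, Nat.sub_add_cancel hdm]
    have h1 : (2 : ℝ) * X ≤ 2 ^ (m - d) := by
      have h2d : (0 : ℝ) < 2 ^ d := by positivity
      rw [← hpow] at hXR
      exact le_of_mul_le_mul_right hXR h2d
    have h2 : ((2 ^ (m - d) : ℕ) : ℝ) ≤ ((a + b : ℕ) : ℝ) := by exact_mod_cast hsupp
    push_cast at h2
    have : ((2 * X : ℕ) : ℝ) ≤ ((a + b : ℕ) : ℝ) := by push_cast; linarith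
    exact_mod_cast this
  exact ⟨by omega, by omega⟩

/-- **the exponential end of the dial is a THEOREM**: `LawAt p 3 (d ↦ (d+1)²·4^{d+1})` for every odd prime. -/
theorem lawAt_exp (p : ℕ) [Fact p.Prime] (hp2 : p ≠ 2) : LawAt p 3 (fun d => (d + 1) ^ 2 * 4 ^ (d + 1)) :=
  fun _ _ hm _ hf => relBal_three_of_exp hp2 hm hf

/-- hence every counterexample to a polynomial member lives BELOW the exponential threshold. -/
theorem lt_exp_of_not_relBal {p : ℕ} [Fact p.Prime] (hp2 : p ≠ 2) {d : ℕ} {f : (Fin m → Bool) → Bool}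
    (hf : HasDegF p f d) (h : ¬ RelBal 3 f) : m < (d + 1) ^ 2 * 4 ^ (d + 1) := by
  by_contra hge
  exact h (relBal_three_of_exp hp2 (not_lt.1 hge) hf)

end Dial


/-! ### §15 The dialed residual and the law-level NORMAL FORM of a minimal counterexample -/

section Residual

/-- **The DIALED RESIDUAL `RelSmolPolyOdd`** (weakest polynomial member the game side consumes) is the proposition
`∀ (p : ℕ) [Fact p.Prime], 5 ≤ p → ∃ B : ℕ, RelSmolLaw p 3 B`: for every prime `p ≥ 5`, SOME polynomial threshold
`A·(d+1)^B` forces ratio-`3` parity balance of every `𝔽_p`-degree-`d` level set.  It is NOT defined in this Theorems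
file (only registered obligations may define propositions under `Summits/`): it is to be BORN as a route item with
exactly that text, and every theorem below states it INLINE.
[UNDECIDED · game-free · FALSE at `τ(d) = 2d` for every ratio (`not_lawAt_two_mul`), TRUE at
`τ(d) = (d+1)²·4^{d+1}` (`lawAt_exp`), floor `B ≥ 2` (`relSmolPolyOdd_floor`, §16) · implied by item 29180]. -/
theorem relSmolPolyOdd_of_tree (h : Theses.PolyFeatureDial.RelSmolOdd) :
    ∀ (p : ℕ) [Fact p.Prime], 5 ≤ p → ∃ B : ℕ, RelSmolLaw p 3 B :=
  fun p _ hp => ⟨2, relSmolOdd_iff_law.1 h p hp⟩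

/-- **NORMAL FORM OF A MINIMAL COUNTEREXAMPLE (law level).**  If the dialed law fails, then at some prime `p ≥ 5`,
for EVERY polynomial scale `(B, A)`, there is a level set `f` of `𝔽_p`-degree `d` on `m` bits with
`A(d+1)^B ≤ m < (d+1)²·4^{d+1}` (above the window the law is the theorem `lawAt_exp`), NOT `3`-balanced, and MIXED
in parity (both parts non-empty — else Beck–Li `eq_false_of_pure` applies since `m > 2d`). -/
theorem normalForm_of_not_relSmolPoly (h : ¬ ∀ (p : ℕ) [Fact p.Prime], 5 ≤ p → ∃ B : ℕ, RelSmolLaw p 3 B) :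
    ∃ (p : ℕ) (_ : Fact p.Prime), 5 ≤ p ∧ ∀ B A : ℕ, ∃ (m d : ℕ) (f : (Fin m → Bool) → Bool),
      A * (d + 1) ^ B ≤ m ∧ m < (d + 1) ^ 2 * 4 ^ (d + 1) ∧ HasDegF p f d ∧ ¬ RelBal 3 f ∧
      (oddPart f).Nonempty ∧ (evenPart f).Nonempty := by
  by_contra hcon
  apply h
  intro p _ hp
  by_contra hno
  apply hcon
  refine ⟨p, ‹_›, hp, fun B A => ?_⟩
  have hp2 : p ≠ 2 := by omega
  -- the law fails at exponent `max B 1` with constant `max A 3`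
  have hfail : ¬ LawAt p 3 (fun d => max A 3 * (d + 1) ^ max B 1) := fun hl => hno ⟨max B 1, max A 3, hl⟩
  unfold LawAt at hfail
  push Not at hfail
  obtain ⟨m, d, hm, f, hf, hbal⟩ := hfail
  have hB : A * (d + 1) ^ B ≤ m := by
    refine le_trans ?_ hm
    exact Nat.mul_le_mul (le_max_left _ _) (Nat.pow_le_pow_right (Nat.succ_pos d) (le_max_left _ _))
  have h2d : 2 * d < m := by
    have h1 : 3 * (d + 1) ≤ max A 3 * (d + 1) ^ max B 1 := by
      calc 3 * (d + 1) = 3 * (d + 1) ^ 1 := by rw [pow_one]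
        _ ≤ max A 3 * (d + 1) ^ max B 1 :=
          Nat.mul_le_mul (le_max_right _ _) (Nat.pow_le_pow_right (Nat.succ_pos d) (le_max_right _ _))
    omega
  exact ⟨m, d, f, hB, lt_exp_of_not_relBal hp2 hf hbal, hf, hbal, parts_nonempty_of_not_relBal hp2 h2d hf hbal⟩

/-- and conversely the law is exactly the absence of the normal form's core (restated for the record). -/
theorem relSmolPolyOdd_of_forall (h : ∀ (p : ℕ) [Fact p.Prime], 5 ≤ p → ∃ B A : ℕ,
      ∀ (m d : ℕ) (f : (Fin m → Bool) → Bool), A * (d + 1) ^ B ≤ m → HasDegF p f d → RelBal 3 f) :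
    ∀ (p : ℕ) [Fact p.Prime], 5 ≤ p → ∃ B : ℕ, RelSmolLaw p 3 B := fun p _ hp => by
  obtain ⟨B, A, hA⟩ := h p hp
  exact ⟨B, A, fun m d hm f hf => hA m d f hm hf⟩

end Residual

/-! ### §16 THE DIAL FROM BELOW: linear thresholds fail for EVERY ratio (`B = 1` is theorem-false)

The extremal family is the classical MOD-`q` weight indicator `χ_q(z) = [q ∣ |z|]`, `q = p^j`
(`𝔽_p`-degree `q − 1` by Lucas + Vandermonde: `χ_q(z) = C(|z| + q − 1, q − 1) mod p`), on `m = 2aq` bits with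
`a` even: its central weight level `aq` is even and alone carries `≥ 2^m / m` points, while every odd-weight point
of the level set has weight `≥ aq + q` or `≤ aq − q`, a Hoeffding tail of mass `≤ 2·e^{−q/a}·2^m`.  Letting
`q = p^j → ∞` with `a` fixed kills every ratio `R` at the LINEAR scale `m = 2a·(d+1)`. -/


end Summit.QuantumAdvantage.QuantumAdvantage.Theorems.PurityDialLaw
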